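import Summits.QuantumFields.BalabanUV.Beta.GAN24.DerivativeRateTransferKKTSourcesFluc
import Summits.QuantumFields.BalabanUV.Beta.GAN24.MonotoneBlocks
import Mathlib.Analysis.Matrix.Order

/-!
# `BalabanUV.Beta.GAN24.DerivativeRateTransferPropagatorDefect` — binder row G-an2-4 ∕ (CONV-C), route R6 «VALUES, NOT DERIVATIVES», PART 45:
# (F1′) IN PROPAGATOR CURRENCY — the second-order consistency row `Λ − H ≤ c₁′·Λ·Λ` of PART 44 is implied by, and modulo the first-order
# two-sided equivalence of the two propagators equivalent to, a ZEROTH-order bound on the TWO-GRID PROPAGATOR DEFECT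
# `E_m := (H + m)⁻¹ − q·(H′ + m·qᵀq)⁻¹·qᵀ ≤ c·1`: the massive coarse propagator minus the block average of Bałaban's soft one-step fine
# propagator `G(m) = (H′ + m·qᵀq)⁻¹`; the mass drops out of the defect `Λ − H`; massless limit; tower END (unit b2b-balaban-gan24-p3, gen 41; v1.2 = v1 with
# the covariant-toy paragraph of the header added (v1.1) and corrected (v1.2) — statements and proofs byte-identical to the staged v1)

NOT IN PRINT; OUR PROOF (for the ROUTE; [folklore] finite-dimensional linear algebra — an2's `Beta.CompositionSingular.{effForm_add_conj, effForm_eq_of_reg,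
minOpL_mul_transpose, minOpL_eq_transpose}` (the `a`-shift and Bałaban's regularised reading «`𝒮 = (QG₁Q*)⁻¹ − a`», [Balaban1985BackgroundPropagators] p. 428
(3.156) — locator only, nothing cited), gan24-p4's `MonotoneBlocks.inv_antitone` (the inverse is Loewner-antitone), PART 44
`DerivativeRateTransferKKTSourcesFluc.jetRange_cons_rate_of_sqConsistency` and Mathlib's `Matrix.PosDef` API BY NAME).
HONEST FRAMING (cell contract, verbatim): «discharging `BetaPertH` makes Bałaban's UV stability UNCONDITIONAL — a real constructive-QFT result; it is NOT
the continuum limit and NOT the Clay problem.»  HONEST DEPENDENCY (verbatim): «continuum YM on T⁴ ⇐ BetaPertH ∧ nine spine estimates (0/9 proved); BetaPertH ⇐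
(D1) ∧ (D4) ∧ CAP+tail; G-an2-4 gates asym, D1 and NE2/3/4.»

WHY THIS FILE.  After PARTs 42–44 the direct road of route R6 reads «(CONS♭) ⟸ (F1′) + (SRC-f) + (AVG) + (VAL₁)» (PRICING-GAN24 v3.44: second reduction shape
accepted; (F1)∕(F1′) PAPER LEMMAS in the scalar toy class, for Bałaban's covariant fibre «NEEDS-ROW + NEEDS-CONSTANT, no holder»).  (F1′) is a SECOND-order
inequality between two quadratic forms (`D := Λ − H ≤ c₁′Λ²`, `Λ = 𝒮(H′,q)` the one-step effective form of the fine form `H′` under the averaging `q`,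
`H` the coarse form).  THIS FILE records that it is the FORM reading of a ZEROTH-order statement about PROPAGATORS: with the LETTERS
  `K_m := H′ + qᵀ(m·1)q` (soft fine form), `G_m := K_m⁻¹` (Bałaban's one-step propagator with averaging weight `a = m`), `P_m := q G_m qᵀ`
  (`= blockProp K_m q`, the block-averaged soft propagator), `C_m := (H + m·1)⁻¹` (massive coarse propagator), `E_m := C_m − P_m` (TWO-GRID DEFECT),
an2's `a`-shift gives `𝒮(K_m, q) = Λ + m·1 = P_m⁻¹` — the mass drops out of `D = (Λ + m) − (H + m)` — and the exact TWO-GRID IDENTITY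
  `⟨v, D v⟩ = ⟨w, E_m w⟩ − ⟨E_m w, (H + m) E_m w⟩`,  `w := (Λ + m)v`,
so (E-ROW) `E_m ≤ c·1` ⟹ (F1′)_m `D ≤ c·(Λ + m)²` for every `m > 0` (no commutativity, no Fourier variable, any background), the massless (F1′) follows
by `m → 0⁺` from an (E-ROW) uniform on `(0, m₀)`, and (STAB) `D ⪰ 0` ⟺ `E_m ⪰ 0`.  Conversely (F1′)_m + the FIRST-order two-sided equivalence
`P_m ≤ C_m ≤ C_Λ·P_m` give `E_m ≤ c(1 + C_Λ)·1`: NO NEW ROW — (E-ROW) is (F1′) in propagator currency, constants `c ↔ c(1 + C_Λ)` (`C_Λ − 1` = the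
kernel row `c_D` of PART 43).  The currency is the one in which two-scale propagator comparisons are printed and in which dense-matrix toys test the
covariant case (two inversions, no KKT solve): records `HOME/b2b-balaban-gan24-p3/gen41/R6-PROPAGATOR-DEFECT-NOTE.md` (kit table: `U = 1`, d = 1:
`E_0 = c₂(L)·1` on mean-zero fields, `c₂(L) = (L²−1)∕(6L²)`; the d = 2 `U(1)`-covariant toy across levels).

WHAT THIS FILE PROVES (0 sorry, 0 `def`, nothing cited):
* §1 (any field) `transpose_mul_smul_one_mul` (`qᵀ(m·1)q = m·qᵀq`), `effForm_soft` (`𝒮(K_m,q) = Λ + m·1`, an2's `a`-shift), **`effForm_add_smul_mul_blockProp`**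
  (`(Λ + m·1)·P_m = 1 = P_m·(Λ + m·1)` — THE MASSIVE EFFECTIVE FORM IS THE INVERSE OF THE BLOCK-AVERAGED SOFT PROPAGATOR, an2's `effForm_eq_of_reg`).
* §2 (`ℝ`, abstract letters `M, Hm, P, C` with `PM = 1`, `HmC = 1`) **`form_sub_eq_defect_sub_energy`** (the two-grid identity), **`form_sub_le_sq_of_defect`**
  (`Hm ⪰ 0`, `C − P ≤ c` ⟹ `M − Hm ≤ c·M·M`), the converse identities `defect_form_eq` ∕ `defect_energy_eq` and **`defect_le_of_sq_of_equiv`**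
  ((F1′)_m + `P ≤ C ≤ C_Λ P` ⟹ `C − P ≤ c(1 + C_Λ)`), `defect_posSemidef_iff` ((STAB) ⟺ `E ⪰ 0`, gan24-p4's `inv_antitone` BY NAME).
* §3 (`ℝ`, the route's letters) `soft_posDef`, `blockProp_soft_posDef`, `massive_posDef` (the three invertibilities from `H, H′ ⪰ 0`, `kkt H′ q` nonsingular,
  `m > 0`), **`sqConsistency_mass_of_propagatorDefect`** ((E-ROW)_m ⟹ (F1′)_m), **`sqConsistency_of_forall_mass`** (the massless limit),
  **`sqConsistency_of_propagatorDefect`** ((E-ROW) on `(0,m₀)` ⟹ PART 44's `hF1` verbatim), `stab_iff_propagatorDefect_nonneg`.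
* §4 THE TOWER END **`jetRange_cons_rate_of_propagatorDefect`**: PART 44's direct END with `hF1` REPLACED by the propagator row — ∀ j, ∃ m₀ > 0, ∀ m ∈ (0,m₀),
  `(H_j + m)⁻¹ − Qf_j (H_{j+1} + m·Qf_jᵀQf_j)⁻¹ Qf_jᵀ ≤ c₁′·1` — + (SRC-f) + (AVG) + (VAL₁) ⟹ `⟨ℋ̃_{j,1}e,(Λ_j − H_j)ℋ̃_{j,1}e⟩ ≤ 2c₁′(c_F + g·V)·θ^j·⟨e,e⟩`.
WHAT IT DOES NOT DO: bound `E_m` for any of Bałaban's ∕ King's operators (the covariant two-grid defect is OPEN — NOT IN PRINT as far as searched, records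
§ presearch; at `U = 1` it is the symbol computation of gan24-idea-1's lens items 7∕8 ∕ `T4Continuum/Support/VariationalOneStepSymbol`); supply (SRC-f), (AVG),
(VAL₁); assert anything printed.
WHAT THE COVARIANT TOY SAYS (DIAGNOSTIC float64, kit j170612 ∕ j170995 ∕ j171034 ∕ j171386, records NOTE §3; d = 2, `U(1)`, smooth zero-flux or uniform-flux backgrounds,
taxi block averages, levels `k ≤ 5`): the decisive property is the CONSISTENCY of the coarse background with the rooting of the block average.  With CORNER-rooted blocks
and contours (Bałaban, CMP 95 (1984) (1.6)–(1.7); CMP 99 (1985) (3.19)) AND the coarse background = Bałaban's AVERAGED gauge field `Ū` (CMP 95 (1.8), CMP 98 (1985) (15)),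
or with CENTRE-rooted blocks (`L` odd; Dimock, arXiv:1108.1335 §2 p. 5) and straight-product coarse links, (STAB) HOLDS at every level, `E_m ⪰ 0`, the composite tower
is Loewner-monotone with the free value rate, and the ONE-MASS rows hold `k`-UNIFORMLY (`c₁′(μη_j²)`, `λ_max E_{μη_j²}` converge in `j`); with CORNER-rooted blocks
against STRAIGHT-PRODUCT coarse links — a transport mismatch of `O(plaquette)` per link, INSIDE the S2 dictionary «straight block-products, `n²·m_k ≤ c_m`» — (STAB)
FAILS at every level (`λ_min(Λ_j − H_j) ≈ −0.5·λ_min(H_j)`), `E_m` is indefinite, the composite tower is not monotone and every constant grows with the level; and in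
EVERY consistent scheme the MASSLESS `c₁′ = sup D∕Λ²` is `k`-uniform but `∝ 1∕s²` for zero-flux backgrounds of amplitude `s` (the would-be zero mode: `Λ`-value
`O(s²η²)`, second-order defect `O(s²η⁴)`).  So for covariant towers the (0, m₀)-uniform hypothesis of §3–§4 is the WRONG currency for a background CLASS; the one-mass
theorem `sqConsistency_mass_of_propagatorDefect` (physical mass `m_j = μη_j²`) is the row the toy supports, and S2's mismatch allowance is too coarse to decide (STAB).
Nothing here is a theorem about Bałaban's operators.  SUPPLIER work on route R6 (rank 2, REDUCTION, no seat); no consumer of record; NEVER «G-an2-4 closed»; NOT (CONV-C), NOT D1,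
NOT `BetaPertH`, NOT continuum, NOT Clay.  Records: `HOME/b2b-balaban-gan24-p3/WOODBURY-FIBRE.md` v14.1.
-/

noncomputable section

open Matrix Filter Topology

namespace Summit.QuantumFields.BalabanUV.Beta.GAN24.DerivativeRateTransferPropagatorDefect

open Literature.MathematicalPhysics.QuantumFieldTheory.Balaban1983to89.Beta.Composition (kkt blockProp)
open Literature.MathematicalPhysics.QuantumFieldTheory.Balaban1983to89.Beta.CompositionSingular (effForm minOp minOpL flucCov effForm_add_conj
  effForm_eq_of_reg minOpL_mul_transpose minOpL_eq_transpose kkt_eq_fromBlocks)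
open Literature.MathematicalPhysics.QuantumFieldTheory.Balaban1983to89.Beta.BorderedJets (dMinOp dEffForm)
open Summit.QuantumFields.BalabanUV.Beta.GAN24.DerivativeRateTransferLoewnerKKT (transpose_eq_of_posSemidef)
open Summit.QuantumFields.BalabanUV.Beta.GAN24.DerivativeRateTransferKKTSources (dotProduct_mulVec_symm)
open Summit.QuantumFields.BalabanUV.Beta.GAN24.DerivativeRateTransferKKTSourcesFluc (jetRange_cons_rate_of_sqConsistency)
open Summit.QuantumFields.BalabanUV.Beta.GAN24.MonotoneBlocks (inv_antitone)

/-! ## §1 The letters: the massive effective form is the inverse of the block-averaged soft propagator (any field) -/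

section Algebra

variable {𝕜 : Type*} [Field 𝕜]
variable {ν μ : Type*} [Fintype ν] [Fintype μ] [DecidableEq ν] [DecidableEq μ]

omit [Fintype ν] [DecidableEq ν] in
/-- [folklore] display: `qᵀ·(m·1)·q = m·(qᵀq)` — the soft averaging weight `a = m` of Bałaban's one-step propagator in an2's `QᵀAQ` letters. -/
theorem transpose_mul_smul_one_mul (q : Matrix μ ν 𝕜) (m : 𝕜) : qᵀ * (m • (1 : Matrix μ μ 𝕜)) * q = m • (qᵀ * q) := by
  rw [Matrix.mul_smul, Matrix.mul_one, Matrix.smul_mul]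

/-- [folklore] `effForm_soft` — an2's `a`-shift at `A = m·1`: `𝒮(H′ + qᵀ(m·1)q, q) = 𝒮(H′, q) + m·1`; the mass enters the effective form additively and the
minimiser ∕ fluctuation covariance not at all (`CompositionSingular.blocks_add_conj`). -/
theorem effForm_soft (H' : Matrix ν ν 𝕜) (q : Matrix μ ν 𝕜) (m : 𝕜) (h : IsUnit (kkt H' q).det) :
    effForm (H' + qᵀ * (m • (1 : Matrix μ μ 𝕜)) * q) q = effForm H' q + m • 1 :=
  effForm_add_conj H' q _ h

/-- **`effForm_add_smul_mul_blockProp` — THE MASSIVE EFFECTIVE FORM IS THE INVERSE OF THE BLOCK-AVERAGED SOFT PROPAGATOR** [folklore; an2's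
`effForm_eq_of_reg` = Bałaban's «`(QG₁Q*)⁻¹ − a`»]: with `K_m := H′ + qᵀ(m·1)q` and `P_m := blockProp K_m q = q·K_m⁻¹·qᵀ` both invertible,
`(𝒮(H′,q) + m·1)·P_m = 1` and `P_m·(𝒮(H′,q) + m·1) = 1`. -/
theorem effForm_add_smul_mul_blockProp (H' : Matrix ν ν 𝕜) (q : Matrix μ ν 𝕜) (m : 𝕜)
    (hK : IsUnit (H' + qᵀ * (m • (1 : Matrix μ μ 𝕜)) * q).det) (hP : IsUnit (blockProp (H' + qᵀ * (m • (1 : Matrix μ μ 𝕜)) * q) q).det) :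
    (effForm H' q + m • 1) * blockProp (H' + qᵀ * (m • (1 : Matrix μ μ 𝕜)) * q) q = 1 ∧
      blockProp (H' + qᵀ * (m • (1 : Matrix μ μ 𝕜)) * q) q * (effForm H' q + m • 1) = 1 := by
  have e : effForm H' q + m • 1 = (blockProp (H' + qᵀ * (m • (1 : Matrix μ μ 𝕜)) * q) q)⁻¹ := by
    rw [effForm_eq_of_reg H' q (m • 1) hK hP, sub_add_cancel]
  rw [e]
  exact ⟨nonsing_inv_mul _ hP, mul_nonsing_inv _ hP⟩

omit [Fintype ν] [DecidableEq ν] [Fintype μ] in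
/-- [folklore] the mass drops out of the defect: `(Λ + m·1) − (H + m·1) = Λ − H`. -/
theorem massive_sub_massive (Λ H : Matrix μ μ 𝕜) (m : 𝕜) : (Λ + m • 1) - (H + m • 1) = Λ - H :=
  add_sub_add_right_eq_sub Λ H (m • 1)

end Algebra

/-! ## §2 The two-grid identity and its two readings (abstract real letters `M = Λ + m`, `Hm = H + m`, `P = M⁻¹`, `C = Hm⁻¹`, `E = C − P`) -/

section Abstract

variable {μ : Type*} [Fintype μ] [DecidableEq μ]
variable {M Hm P C : Matrix μ μ ℝ}

/-- **`form_sub_eq_defect_sub_energy` — THE TWO-GRID IDENTITY** [folklore; our bookkeeping]: `M, Hm` symmetric, `P·M = 1`, `Hm·C = 1` ⟹ for every `v`, with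
`w := Mv`:  `⟨v,(M − Hm)v⟩ = ⟨w,(C − P)w⟩ − ⟨(C − P)w, Hm (C − P)w⟩`  (the form defect is the propagator defect MINUS the `Hm`-energy of the defect field
`(C − P)w = Cw − v`). -/
theorem form_sub_eq_defect_sub_energy (hMs : Mᵀ = M) (hHs : Hmᵀ = Hm) (hPM : P * M = 1) (hHC : Hm * C = 1) (v : μ → ℝ) :
    v ⬝ᵥ ((M - Hm) *ᵥ v) =
      (M *ᵥ v) ⬝ᵥ ((C - P) *ᵥ (M *ᵥ v)) - ((C - P) *ᵥ (M *ᵥ v)) ⬝ᵥ (Hm *ᵥ ((C - P) *ᵥ (M *ᵥ v))) := by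
  have hv : P *ᵥ (M *ᵥ v) = v := by rw [mulVec_mulVec, hPM, one_mulVec]
  have hCw : Hm *ᵥ (C *ᵥ (M *ᵥ v)) = M *ᵥ v := by rw [mulVec_mulVec, hHC, one_mulVec]
  have e1 : (C - P) *ᵥ (M *ᵥ v) = C *ᵥ (M *ᵥ v) - v := by rw [sub_mulVec, hv]
  have s1 : (C *ᵥ (M *ᵥ v)) ⬝ᵥ (Hm *ᵥ v) = (M *ᵥ v) ⬝ᵥ v := by
    rw [dotProduct_mulVec_symm hHs, hCw]
  have s2 : v ⬝ᵥ (M *ᵥ v) = (M *ᵥ v) ⬝ᵥ v := dotProduct_mulVec_symm hMs v v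
  have s3 : (C *ᵥ (M *ᵥ v)) ⬝ᵥ (M *ᵥ v) = (M *ᵥ v) ⬝ᵥ (C *ᵥ (M *ᵥ v)) := dotProduct_comm _ _
  have s4 : v ⬝ᵥ (M *ᵥ v) = (M *ᵥ v) ⬝ᵥ v := s2
  rw [e1, mulVec_sub Hm, hCw, sub_mulVec, dotProduct_sub]
  simp only [sub_dotProduct, dotProduct_sub]
  linarith [s1, s3, s4]

/-- **`form_sub_le_sq_of_defect` — (F1′) AT MASS `m` FROM THE PROPAGATOR-DEFECT ROW** [our proof]: `M, Hm` symmetric, `Hm ⪰ 0`, `P·M = 1`, `Hm·C = 1` and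
(E-ROW) `⟨w,(C − P)w⟩ ≤ c⟨w,w⟩` for all `w` ⟹ `⟨v,(M − Hm)v⟩ ≤ c·⟨Mv,Mv⟩` for all `v` (drop the `Hm`-energy in the two-grid identity). -/
theorem form_sub_le_sq_of_defect (hMs : Mᵀ = M) (hHs : Hmᵀ = Hm) (hHp : Hm.PosSemidef) (hPM : P * M = 1) (hHC : Hm * C = 1) {c : ℝ}
    (hE : ∀ w : μ → ℝ, w ⬝ᵥ ((C - P) *ᵥ w) ≤ c * (w ⬝ᵥ w)) (v : μ → ℝ) :
    v ⬝ᵥ ((M - Hm) *ᵥ v) ≤ c * ((M *ᵥ v) ⬝ᵥ (M *ᵥ v)) := by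
  rw [form_sub_eq_defect_sub_energy hMs hHs hPM hHC v]
  have h0 : 0 ≤ ((C - P) *ᵥ (M *ᵥ v)) ⬝ᵥ (Hm *ᵥ ((C - P) *ᵥ (M *ᵥ v))) := by
    have := hHp.dotProduct_mulVec_nonneg ((C - P) *ᵥ (M *ᵥ v)); rwa [star_trivial] at this
  linarith [hE (M *ᵥ v)]

/-- [folklore; our bookkeeping] the converse identity I: `C` symmetric, `P·M = 1`, `C·Hm = 1` ⟹ with `u` and `w := Mu`:
`⟨w,(C − P)w⟩ = ⟨u,(M − Hm)u⟩ + ⟨(M − Hm)u, C (M − Hm)u⟩` (the propagator defect is the form defect PLUS the `C`-energy of `(M − Hm)u`). -/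
theorem defect_form_eq (hCs : Cᵀ = C) (hPM : P * M = 1) (hCH : C * Hm = 1) (u : μ → ℝ) :
    (M *ᵥ u) ⬝ᵥ ((C - P) *ᵥ (M *ᵥ u)) = u ⬝ᵥ ((M - Hm) *ᵥ u) + ((M - Hm) *ᵥ u) ⬝ᵥ (C *ᵥ ((M - Hm) *ᵥ u)) := by
  have hv : P *ᵥ (M *ᵥ u) = u := by rw [mulVec_mulVec, hPM, one_mulVec]
  have hCH' : C *ᵥ (Hm *ᵥ u) = u := by rw [mulVec_mulVec, hCH, one_mulVec]
  have s1 : (Hm *ᵥ u) ⬝ᵥ (C *ᵥ (M *ᵥ u)) = u ⬝ᵥ (M *ᵥ u) := by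
    rw [dotProduct_mulVec_symm hCs, hCH']
  have s2 : (M *ᵥ u) ⬝ᵥ (C *ᵥ (Hm *ᵥ u)) = (M *ᵥ u) ⬝ᵥ u := by rw [hCH']
  have s3 : u ⬝ᵥ (M *ᵥ u) = (M *ᵥ u) ⬝ᵥ u := dotProduct_comm _ _
  have s4 : (Hm *ᵥ u) ⬝ᵥ u = u ⬝ᵥ (Hm *ᵥ u) := dotProduct_comm _ _
  have s5 : (M *ᵥ u) ⬝ᵥ (P *ᵥ (M *ᵥ u)) = (M *ᵥ u) ⬝ᵥ u := by rw [hv]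
  have s6 : (Hm *ᵥ u) ⬝ᵥ (C *ᵥ (Hm *ᵥ u)) = (Hm *ᵥ u) ⬝ᵥ u := by rw [hCH']
  simp only [sub_mulVec, mulVec_sub, sub_dotProduct, dotProduct_sub]
  linarith [s1, s2, s3, s4, s5, s6]

/-- [folklore; our bookkeeping] the converse identity II: `P` symmetric, `P·M = 1`, `C·Hm = 1` ⟹
`⟨(M − Hm)u, P (M − Hm)u⟩ = ⟨u,(M − Hm)u⟩ − ⟨Hm u,(C − P)(Hm u)⟩`. -/
theorem defect_energy_eq (hPs : Pᵀ = P) (hPM : P * M = 1) (hCH : C * Hm = 1) (u : μ → ℝ) :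
    ((M - Hm) *ᵥ u) ⬝ᵥ (P *ᵥ ((M - Hm) *ᵥ u)) = u ⬝ᵥ ((M - Hm) *ᵥ u) - (Hm *ᵥ u) ⬝ᵥ ((C - P) *ᵥ (Hm *ᵥ u)) := by
  have hv : P *ᵥ (M *ᵥ u) = u := by rw [mulVec_mulVec, hPM, one_mulVec]
  have hCH' : C *ᵥ (Hm *ᵥ u) = u := by rw [mulVec_mulVec, hCH, one_mulVec]
  have s1 : (M *ᵥ u) ⬝ᵥ (P *ᵥ (Hm *ᵥ u)) = u ⬝ᵥ (Hm *ᵥ u) := by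
    rw [dotProduct_mulVec_symm hPs, hv]
  have s2 : (M *ᵥ u) ⬝ᵥ (P *ᵥ (M *ᵥ u)) = (M *ᵥ u) ⬝ᵥ u := by rw [hv]
  have s3 : u ⬝ᵥ (M *ᵥ u) = (M *ᵥ u) ⬝ᵥ u := dotProduct_comm _ _
  have s4 : (Hm *ᵥ u) ⬝ᵥ u = u ⬝ᵥ (Hm *ᵥ u) := dotProduct_comm _ _
  have s5 : (Hm *ᵥ u) ⬝ᵥ (C *ᵥ (Hm *ᵥ u)) = (Hm *ᵥ u) ⬝ᵥ u := by rw [hCH']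
  have s6 : (Hm *ᵥ u) ⬝ᵥ (P *ᵥ (M *ᵥ u)) = (Hm *ᵥ u) ⬝ᵥ u := by rw [hv]
  simp only [sub_mulVec, mulVec_sub, sub_dotProduct, dotProduct_sub]
  linarith [s1, s2, s3, s4, s5, s6]

/-- **`defect_le_of_sq_of_equiv` — THE CONVERSE: (E-ROW) ⟸ (F1′)_m + THE FIRST-ORDER TWO-SIDED EQUIVALENCE OF THE PROPAGATORS** [our proof]: `P, C` symmetric,
`P·M = 1 = M·P`, `C·Hm = 1`, (F1′)_m `⟨u,(M − Hm)u⟩ ≤ c⟨Mu,Mu⟩`, (STAB)_prop `⟨x,Px⟩ ≤ ⟨x,Cx⟩` and (UB)_prop `⟨x,Cx⟩ ≤ C_Λ⟨x,Px⟩` (`C_Λ ≥ 0`) for all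
`u, x` ⟹ `⟨w,(C − P)w⟩ ≤ c(1 + C_Λ)⟨w,w⟩` for all `w` — NO NEW ROW: the propagator-defect row is (F1′) read in propagator currency. -/
theorem defect_le_of_sq_of_equiv (hPs : Pᵀ = P) (hCs : Cᵀ = C) (hPM : P * M = 1) (hMP : M * P = 1) (hCH : C * Hm = 1) {c CΛ : ℝ} (hCΛ : 0 ≤ CΛ)
    (hF1 : ∀ u : μ → ℝ, u ⬝ᵥ ((M - Hm) *ᵥ u) ≤ c * ((M *ᵥ u) ⬝ᵥ (M *ᵥ u)))
    (hstab : ∀ x : μ → ℝ, x ⬝ᵥ (P *ᵥ x) ≤ x ⬝ᵥ (C *ᵥ x)) (hub : ∀ x : μ → ℝ, x ⬝ᵥ (C *ᵥ x) ≤ CΛ * (x ⬝ᵥ (P *ᵥ x))) (w : μ → ℝ) :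
    w ⬝ᵥ ((C - P) *ᵥ w) ≤ c * (1 + CΛ) * (w ⬝ᵥ w) := by
  set u : μ → ℝ := P *ᵥ w with hu
  have hw : M *ᵥ u = w := by rw [hu, mulVec_mulVec, hMP, one_mulVec]
  rw [← hw, defect_form_eq hCs hPM hCH u]
  have h1 := hF1 u
  have h2 := hub ((M - Hm) *ᵥ u)
  have h3 : ((M - Hm) *ᵥ u) ⬝ᵥ (P *ᵥ ((M - Hm) *ᵥ u)) ≤ u ⬝ᵥ ((M - Hm) *ᵥ u) := by
    rw [defect_energy_eq hPs hPM hCH u]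
    have h0 : 0 ≤ (Hm *ᵥ u) ⬝ᵥ ((C - P) *ᵥ (Hm *ᵥ u)) := by
      rw [sub_mulVec, dotProduct_sub]; linarith [hstab (Hm *ᵥ u)]
    linarith
  have h4 : ((M - Hm) *ᵥ u) ⬝ᵥ (C *ᵥ ((M - Hm) *ᵥ u)) ≤ CΛ * (u ⬝ᵥ ((M - Hm) *ᵥ u)) :=
    h2.trans (mul_le_mul_of_nonneg_left h3 hCΛ)
  have h5 := mul_le_mul_of_nonneg_left h1 (by positivity : (0 : ℝ) ≤ 1 + CΛ)
  nlinarith [h4, h5]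

/-- **`defect_posSemidef_iff` — (STAB) ⟺ `E ⪰ 0`** [folklore; gan24-p4's `MonotoneBlocks.inv_antitone` BY NAME, both directions]: for positive definite
`M, Hm` with `P = M⁻¹`, `C = Hm⁻¹`: `(M − Hm) ⪰ 0 ⟺ (C − P) ⪰ 0`. -/
theorem defect_posSemidef_iff (hM : M.PosDef) (hHm : Hm.PosDef) (hP : P = M⁻¹) (hC : C = Hm⁻¹) :
    (M - Hm).PosSemidef ↔ (C - P).PosSemidef := by
  constructor
  · intro h; rw [hP, hC]; exact inv_antitone hHm hM h
  · intro h
    have h' := inv_antitone (hP ▸ hM.inv) (hC ▸ hHm.inv) h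
    have hMu : IsUnit M.det := (isUnit_iff_isUnit_det _).mp hM.isUnit
    have hHu : IsUnit Hm.det := (isUnit_iff_isUnit_det _).mp hHm.isUnit
    rwa [hP, hC, nonsing_inv_nonsing_inv _ hMu, nonsing_inv_nonsing_inv _ hHu] at h'

end Abstract

/-! ## §3 The route's letters: `K_m = H′ + qᵀ(m·1)q`, `P_m = blockProp K_m q`, `C_m = (H + m·1)⁻¹`; (E-ROW)_m ⟹ (F1′)_m; the massless limit -/

section Route

variable {ν μ : Type*} [Fintype ν] [Fintype μ] [DecidableEq ν] [DecidableEq μ]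
variable {H : Matrix μ μ ℝ} {H' : Matrix ν ν ℝ} {q : Matrix μ ν ℝ} {m : ℝ}

/-- [folklore] `soft_posDef`: `H′ ⪰ 0`, `kkt H′ q` nonsingular, `m > 0` ⟹ the soft fine form `K_m = H′ + qᵀ(m·1)q` is positive definite (a vector killed by
`K_m` has `qφ = 0` and `H′φ = 0`, hence lies in the kernel of the bordered matrix). -/
theorem soft_posDef (hH' : H'.PosSemidef) (hk : IsUnit (kkt H' q).det) (hm : 0 < m) :
    (H' + qᵀ * (m • (1 : Matrix μ μ ℝ)) * q).PosDef := by
  have hB : (qᵀ * (m • (1 : Matrix μ μ ℝ)) * q).PosSemidef := by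
    have := (Matrix.PosSemidef.one.smul hm.le : (m • (1 : Matrix μ μ ℝ)).PosSemidef).conjTranspose_mul_mul_same q
    simpa only [conjTranspose_eq_transpose_of_trivial] using this
  have hK : (H' + qᵀ * (m • (1 : Matrix μ μ ℝ)) * q).PosSemidef := hH'.add hB
  refine Matrix.PosDef.of_dotProduct_mulVec_pos hK.isHermitian fun x hx => ?_
  refine lt_of_le_of_ne (by simpa only [star_trivial] using hK.dotProduct_mulVec_nonneg x) fun h0 => hx ?_
  -- `⟨x,K x⟩ = ⟨x,H′x⟩ + m‖qx‖² = 0` ⟹ `qx = 0`, `H′x = 0` ⟹ `kkt H′ q (x,0) = 0` ⟹ `x = 0`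
  have hsplit : star x ⬝ᵥ ((H' + qᵀ * (m • (1 : Matrix μ μ ℝ)) * q) *ᵥ x) =
      x ⬝ᵥ (H' *ᵥ x) + m * ((q *ᵥ x) ⬝ᵥ (q *ᵥ x)) := by
    rw [star_trivial, add_mulVec, dotProduct_add, transpose_mul_smul_one_mul, smul_mulVec, dotProduct_smul, ← mulVec_mulVec,
      dotProduct_mulVec x qᵀ, vecMul_transpose, smul_eq_mul]
  have h1 : 0 ≤ x ⬝ᵥ (H' *ᵥ x) := by simpa only [star_trivial] using hH'.dotProduct_mulVec_nonneg x
  have h2 : 0 ≤ (q *ᵥ x) ⬝ᵥ (q *ᵥ x) := by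
    simpa only [star_trivial, one_mulVec] using Matrix.PosSemidef.one.dotProduct_mulVec_nonneg (n := μ) (R := ℝ) (q *ᵥ x)
  rw [hsplit] at h0
  have hq0 : (q *ᵥ x) ⬝ᵥ (q *ᵥ x) = 0 := by nlinarith [mul_nonneg hm.le h2]
  have hqx : q *ᵥ x = 0 := dotProduct_self_eq_zero.mp hq0
  have hHx0 : x ⬝ᵥ (H' *ᵥ x) = 0 := by nlinarith [mul_nonneg hm.le h2]
  have hHx : H' *ᵥ x = 0 := by
    have := (hH'.dotProduct_mulVec_zero_iff x); rw [star_trivial] at this; exact this.mp hHx0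
  have hkx : kkt H' q *ᵥ Sum.elim x 0 = 0 := by
    rw [kkt_eq_fromBlocks, fromBlocks_mulVec]
    funext i
    cases i with
    | inl i => simp [Sum.elim_comp_inl, Sum.elim_comp_inr, hHx]
    | inr i => simp [Sum.elim_comp_inl, Sum.elim_comp_inr, hqx]
  have hinj : Function.Injective (kkt H' q).mulVec := mulVec_injective_iff_isUnit.mpr ((isUnit_iff_isUnit_det _).mpr hk)
  have h00 : (Sum.elim x 0 : ν ⊕ μ → ℝ) = 0 := hinj (by rw [hkx, mulVec_zero])
  funext i
  have := congrFun h00 (Sum.inl i)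
  simpa using this

/-- [folklore] `blockProp_soft_posDef`: under the same hypotheses the block-averaged soft propagator `P_m = q·K_m⁻¹·qᵀ` is positive definite (`K_m⁻¹ ≻ 0` and `qᵀ`
is injective because `ℋᴸqᵀ = 1`). -/
theorem blockProp_soft_posDef (hH' : H'.PosSemidef) (hk : IsUnit (kkt H' q).det) (hm : 0 < m) :
    (blockProp (H' + qᵀ * (m • (1 : Matrix μ μ ℝ)) * q) q).PosDef := by
  have hKi := (soft_posDef hH' hk hm).inv
  have hinj : Function.Injective q.vecMul := by
    intro a b hab
    have hab' : a ᵥ* q = b ᵥ* q := hab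
    have hL := minOpL_mul_transpose H' q hk
    have key : ∀ w : μ → ℝ, minOpL H' q *ᵥ (w ᵥ* q) = w := fun w => by
      rw [← mulVec_transpose, mulVec_mulVec, hL, one_mulVec]
    rw [← key a, ← key b, hab']
  have := hKi.mul_mul_conjTranspose_same hinj
  simpa only [blockProp, conjTranspose_eq_transpose_of_trivial] using this

omit [Fintype ν] [DecidableEq ν] [Fintype μ] in
/-- [folklore] `massive_posDef`: `H ⪰ 0`, `m > 0` ⟹ `H + m·1 ≻ 0`. -/
theorem massive_posDef (hH : H.PosSemidef) (hm : 0 < m) : (H + m • (1 : Matrix μ μ ℝ)).PosDef :=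
  Matrix.PosDef.posSemidef_add hH (Matrix.PosDef.one.smul hm)

/-- **`sqConsistency_mass_of_propagatorDefect` — (E-ROW)_m ⟹ (F1′)_m IN THE ROUTE'S LETTERS** [our proof]: `H, H′ ⪰ 0`, `kkt H′ q` nonsingular, `m > 0` and
the TWO-GRID PROPAGATOR-DEFECT ROW `⟨w,((H + m·1)⁻¹ − q(H′ + qᵀ(m·1)q)⁻¹qᵀ)w⟩ ≤ c⟨w,w⟩` for all `w` ⟹
`⟨v,(𝒮(H′,q) − H)v⟩ ≤ c·⟨(𝒮(H′,q) + m·1)v,(𝒮(H′,q) + m·1)v⟩` for all `v`. -/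
theorem sqConsistency_mass_of_propagatorDefect (hH : H.PosSemidef) (hH' : H'.PosSemidef) (hk : IsUnit (kkt H' q).det) (hm : 0 < m) {c : ℝ}
    (hE : ∀ w : μ → ℝ, w ⬝ᵥ (((H + m • (1 : Matrix μ μ ℝ))⁻¹ - blockProp (H' + qᵀ * (m • (1 : Matrix μ μ ℝ)) * q) q) *ᵥ w) ≤ c * (w ⬝ᵥ w))
    (v : μ → ℝ) :
    v ⬝ᵥ ((effForm H' q - H) *ᵥ v) ≤ c * (((effForm H' q + m • 1) *ᵥ v) ⬝ᵥ ((effForm H' q + m • 1) *ᵥ v)) := by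
  have hKd : IsUnit (H' + qᵀ * (m • (1 : Matrix μ μ ℝ)) * q).det := (isUnit_iff_isUnit_det _).mp (soft_posDef hH' hk hm).isUnit
  have hPd : IsUnit (blockProp (H' + qᵀ * (m • (1 : Matrix μ μ ℝ)) * q) q).det :=
    (isUnit_iff_isUnit_det _).mp (blockProp_soft_posDef hH' hk hm).isUnit
  have hHm := massive_posDef hH hm
  have hCd : IsUnit (H + m • (1 : Matrix μ μ ℝ)).det := (isUnit_iff_isUnit_det _).mp hHm.isUnit
  have hPM := (effForm_add_smul_mul_blockProp H' q m hKd hPd).2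
  have hΛs : (effForm H' q)ᵀ = effForm H' q := (minOpL_eq_transpose H' q (transpose_eq_of_posSemidef hH')).2.2
  have hMs : (effForm H' q + m • (1 : Matrix μ μ ℝ))ᵀ = effForm H' q + m • 1 := by
    rw [transpose_add, hΛs, transpose_smul, transpose_one]
  have hHs : (H + m • (1 : Matrix μ μ ℝ))ᵀ = H + m • 1 := by
    rw [transpose_add, transpose_eq_of_posSemidef hH, transpose_smul, transpose_one]
  have key := form_sub_le_sq_of_defect hMs hHs hHm.posSemidef hPM (mul_nonsing_inv _ hCd) hE v
  rwa [massive_sub_massive] at key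

omit [DecidableEq μ] in
/-- **`sqConsistency_of_forall_mass` — THE MASSLESS LIMIT** [folklore]: if `⟨v,Dv⟩ ≤ c·‖(Λ + m·1)v‖²` for every `m ∈ (0, m₀)` then `⟨v,Dv⟩ ≤ c·‖Λv‖²`
(the right side is a polynomial in `m`; let `m → 0⁺`). -/
theorem sqConsistency_of_forall_mass [DecidableEq μ] {Λ D : Matrix μ μ ℝ} {c m₀ : ℝ} (hm₀ : 0 < m₀)
    (h : ∀ m ∈ Set.Ioo (0 : ℝ) m₀, ∀ v : μ → ℝ, v ⬝ᵥ (D *ᵥ v) ≤ c * (((Λ + m • (1 : Matrix μ μ ℝ)) *ᵥ v) ⬝ᵥ ((Λ + m • (1 : Matrix μ μ ℝ)) *ᵥ v)))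
    (v : μ → ℝ) : v ⬝ᵥ (D *ᵥ v) ≤ c * ((Λ *ᵥ v) ⬝ᵥ (Λ *ᵥ v)) := by
  set a : μ → ℝ := Λ *ᵥ v with ha
  have hexp : ∀ m : ℝ, c * (((Λ + m • (1 : Matrix μ μ ℝ)) *ᵥ v) ⬝ᵥ ((Λ + m • (1 : Matrix μ μ ℝ)) *ᵥ v)) =
      c * (a ⬝ᵥ a + 2 * m * (a ⬝ᵥ v) + m ^ 2 * (v ⬝ᵥ v)) := fun m => by
    have e : (Λ + m • (1 : Matrix μ μ ℝ)) *ᵥ v = a + m • v := by rw [add_mulVec, smul_mulVec, one_mulVec]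
    rw [e]
    simp only [add_dotProduct, dotProduct_add, smul_dotProduct, dotProduct_smul, smul_eq_mul, dotProduct_comm v a]
    ring
  have hcont : Tendsto (fun m : ℝ => c * (a ⬝ᵥ a + 2 * m * (a ⬝ᵥ v) + m ^ 2 * (v ⬝ᵥ v))) (𝓝[>] 0)
      (𝓝 (c * (a ⬝ᵥ a + 2 * 0 * (a ⬝ᵥ v) + 0 ^ 2 * (v ⬝ᵥ v)))) := by
    have hc : Continuous fun m : ℝ => c * (a ⬝ᵥ a + 2 * m * (a ⬝ᵥ v) + m ^ 2 * (v ⬝ᵥ v)) := by continuity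
    exact (hc.tendsto 0).mono_left nhdsWithin_le_nhds
  have hev : ∀ᶠ m in 𝓝[>] (0 : ℝ), v ⬝ᵥ (D *ᵥ v) ≤ c * (a ⬝ᵥ a + 2 * m * (a ⬝ᵥ v) + m ^ 2 * (v ⬝ᵥ v)) :=
    Filter.eventually_of_mem (Ioo_mem_nhdsGT hm₀) fun m hm => by rw [← hexp m]; exact h m hm v
  have := ge_of_tendsto hcont hev
  simpa only [mul_zero, zero_mul, add_zero, ne_eq, OfNat.ofNat_ne_zero, not_false_eq_true, zero_pow] using this

/-- **`sqConsistency_of_propagatorDefect` — PART 44's `hF1` FROM THE PROPAGATOR ROW** [our proof]: `H, H′ ⪰ 0`, `kkt H′ q` nonsingular and (E-ROW) on a mass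
window — `∃ m₀ > 0, ∀ m ∈ (0,m₀), ∀ w, ⟨w,((H + m·1)⁻¹ − q(H′ + qᵀ(m·1)q)⁻¹qᵀ)w⟩ ≤ c⟨w,w⟩` — ⟹ (F1′) `⟨v,(𝒮(H′,q) − H)v⟩ ≤ c⟨𝒮(H′,q)v, 𝒮(H′,q)v⟩` ∀ `v`. -/
theorem sqConsistency_of_propagatorDefect (hH : H.PosSemidef) (hH' : H'.PosSemidef) (hk : IsUnit (kkt H' q).det) {c : ℝ}
    (hE : ∃ m₀ : ℝ, 0 < m₀ ∧ ∀ m ∈ Set.Ioo (0 : ℝ) m₀, ∀ w : μ → ℝ,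
      w ⬝ᵥ (((H + m • (1 : Matrix μ μ ℝ))⁻¹ - blockProp (H' + qᵀ * (m • (1 : Matrix μ μ ℝ)) * q) q) *ᵥ w) ≤ c * (w ⬝ᵥ w))
    (v : μ → ℝ) : v ⬝ᵥ ((effForm H' q - H) *ᵥ v) ≤ c * ((effForm H' q *ᵥ v) ⬝ᵥ (effForm H' q *ᵥ v)) := by
  obtain ⟨m₀, hm₀, hE⟩ := hE
  exact sqConsistency_of_forall_mass hm₀ (fun m hm w => sqConsistency_mass_of_propagatorDefect hH hH' hk hm.1 (hE m hm) w) v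

/-- **`stab_iff_propagatorDefect_nonneg` — (STAB) ⟺ `E_m ⪰ 0`** [folklore; gan24-p4's `inv_antitone` BY NAME]: `H, H′ ⪰ 0`, `kkt H′ q` nonsingular, `m > 0` ⟹
(`𝒮(H′,q) − H ⪰ 0` ⟺ `(H + m·1)⁻¹ − q(H′ + qᵀ(m·1)q)⁻¹qᵀ ⪰ 0`): one averaging step does not increase the energy iff the block-averaged soft fine propagator is
dominated by the massive coarse one. -/
theorem stab_iff_propagatorDefect_nonneg (hH : H.PosSemidef) (hH' : H'.PosSemidef) (hk : IsUnit (kkt H' q).det) (hm : 0 < m) :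
    (effForm H' q - H).PosSemidef ↔
      ((H + m • (1 : Matrix μ μ ℝ))⁻¹ - blockProp (H' + qᵀ * (m • (1 : Matrix μ μ ℝ)) * q) q).PosSemidef := by
  have hK := soft_posDef hH' hk hm
  have hKd : IsUnit (H' + qᵀ * (m • (1 : Matrix μ μ ℝ)) * q).det := (isUnit_iff_isUnit_det _).mp hK.isUnit
  have hPpd := blockProp_soft_posDef hH' hk hm
  have hPd : IsUnit (blockProp (H' + qᵀ * (m • (1 : Matrix μ μ ℝ)) * q) q).det := (isUnit_iff_isUnit_det _).mp hPpd.isUnit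
  have hHm := massive_posDef hH hm
  have eM : effForm H' q + m • 1 = (blockProp (H' + qᵀ * (m • (1 : Matrix μ μ ℝ)) * q) q)⁻¹ := by
    rw [effForm_eq_of_reg H' q (m • 1) hKd hPd, sub_add_cancel]
  have hM : (effForm H' q + m • (1 : Matrix μ μ ℝ)).PosDef := eM ▸ hPpd.inv
  have hP : blockProp (H' + qᵀ * (m • (1 : Matrix μ μ ℝ)) * q) q = (effForm H' q + m • 1)⁻¹ := by
    rw [eM, nonsing_inv_nonsing_inv _ hPd]
  rw [← massive_sub_massive (effForm H' q) H m]
  exact defect_posSemidef_iff hM hHm hP rfl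

end Route

/-! ## §4 The tower END: PART 44's direct road with `hF1` replaced by the propagator-defect row -/

section Tower

variable {c : Type*} [Fintype c] [DecidableEq c]
variable {ι : ℕ → Type*} [∀ j, Fintype (ι j)] [∀ j, DecidableEq (ι j)]
variable {H : ∀ j, Matrix (ι j) (ι j) ℝ} {Qf : ∀ j, Matrix (ι j) (ι (j + 1)) ℝ} {Qc : ∀ j, Matrix c (ι j) ℝ}
variable {Λ₁ : ∀ j, Matrix (ι j) (ι j) ℝ} {Q₁ : ∀ j, Matrix c (ι j) ℝ} {c₁ cF g V θ : ℝ}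

/-- **`jetRange_cons_rate_of_propagatorDefect` — THE DIRECT TOWER END FROM THE PROPAGATOR ROW** [our proof; PART 44 `jetRange_cons_rate_of_sqConsistency` BY NAME
with its `hF1` DISCHARGED from (E-ROW)]: with `Λ_j := 𝒮(H (j+1), Qf j)`: `H j ⪰ 0` ∀ j, nonsingular `kkt (H (j+1)) (Qf j)` and `kkt Λ_j (Qc j)`, (E-ROW)_j — for
every `j` a mass window `(0, m₀)` on which `(H_j + m·1)⁻¹ − Qf_j·(H_{j+1} + Qf_jᵀ(m·1)Qf_j)⁻¹·Qf_jᵀ ≤ c₁′·1` (`c₁′ ≥ 0`) —, (SRC-f) `⟨f_{j,1}e,f_{j,1}e⟩ ≤ c_F θ^j⟨e,e⟩`,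
(AVG) `⟨(Qc j)ᵀw,(Qc j)ᵀw⟩ ≤ g θ^j⟨w,w⟩`, (VAL₁) `⟨𝒮₁e,𝒮₁e⟩ ≤ V⟨e,e⟩` ⟹ `⟨ℋ̃_{j,1}e,(Λ_j − H_j)ℋ̃_{j,1}e⟩ ≤ 2c₁′(c_F + g·V)·θ^j·⟨e,e⟩` ∀ j e. -/
theorem jetRange_cons_rate_of_propagatorDefect (hH : ∀ j, (H j).PosSemidef) (hkf : ∀ j, IsUnit (kkt (H (j + 1)) (Qf j)).det)
    (hkΛ : ∀ j, IsUnit (kkt (effForm (H (j + 1)) (Qf j)) (Qc j)).det) (hc₁ : 0 ≤ c₁) (hg : 0 ≤ g) (hθ : 0 ≤ θ)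
    (hE : ∀ j, ∃ m₀ : ℝ, 0 < m₀ ∧ ∀ m ∈ Set.Ioo (0 : ℝ) m₀, ∀ w : ι j → ℝ,
      w ⬝ᵥ (((H j + m • (1 : Matrix (ι j) (ι j) ℝ))⁻¹ -
        blockProp (H (j + 1) + (Qf j)ᵀ * (m • (1 : Matrix (ι j) (ι j) ℝ)) * Qf j) (Qf j)) *ᵥ w) ≤ c₁ * (w ⬝ᵥ w))
    (hF : ∀ j (e : c → ℝ),
      (((Q₁ j)ᵀ * effForm (effForm (H (j + 1)) (Qf j)) (Qc j) - Λ₁ j * minOp (effForm (H (j + 1)) (Qf j)) (Qc j)) *ᵥ e) ⬝ᵥ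
          (((Q₁ j)ᵀ * effForm (effForm (H (j + 1)) (Qf j)) (Qc j) - Λ₁ j * minOp (effForm (H (j + 1)) (Qf j)) (Qc j)) *ᵥ e) ≤ cF * θ ^ j * (e ⬝ᵥ e))
    (hQt : ∀ j (w : c → ℝ), ((Qc j)ᵀ *ᵥ w) ⬝ᵥ ((Qc j)ᵀ *ᵥ w) ≤ g * θ ^ j * (w ⬝ᵥ w))
    (hV : ∀ j (e : c → ℝ), (dEffForm (effForm (H (j + 1)) (Qf j)) (Qc j) (Λ₁ j) (Q₁ j) *ᵥ e) ⬝ᵥ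
      (dEffForm (effForm (H (j + 1)) (Qf j)) (Qc j) (Λ₁ j) (Q₁ j) *ᵥ e) ≤ V * (e ⬝ᵥ e)) :
    ∀ j (e : c → ℝ), (dMinOp (effForm (H (j + 1)) (Qf j)) (Qc j) (Λ₁ j) (Q₁ j) *ᵥ e) ⬝ᵥ
        ((effForm (H (j + 1)) (Qf j) - H j) *ᵥ (dMinOp (effForm (H (j + 1)) (Qf j)) (Qc j) (Λ₁ j) (Q₁ j) *ᵥ e)) ≤
      2 * c₁ * (cF + g * V) * θ ^ j * (e ⬝ᵥ e) :=
  jetRange_cons_rate_of_sqConsistency hkΛ hc₁ hg hθ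
    (fun j v => sqConsistency_of_propagatorDefect (hH j) (hH (j + 1)) (hkf j) (hE j) v) hF hQt hV

end Tower

end Summit.QuantumFields.BalabanUV.Beta.GAN24.DerivativeRateTransferPropagatorDefect
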